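import Summits.ABC.IUTFork.Joshi.ATS4DescentSpineAbc
import Summits.ABC.IUTFork.Joshi.ATS4MainBoundsGenuine
import HarnessLib

/-!
# [J-IV] (arXiv:2403.10430v2) §6.4 / §6.12 ⟶ §7: the E5 DESCENT SPINE to Thm 7.2.1 / `ABC` as typed with the §6.4
# conjunct COLLAPSED (to Lemma 6.4.2 (2)) and, on GENUINE Galois number-field towers, REMOVED

Proof-only companion (0 defs) of the abc-iut cell, branch E «type Joshi's construction, test vs S» (rung LADDER-ABC:A2.E), seat
abc-iut-E-t33 (gen 4), slot T-33 = [J-IV] §7; authors-first sequel of `Joshi/ATS4DescentSpineAbc.lean` (p437546) on the BUILT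
parent `Joshi/ATS4MainBoundsGenuine.lean` (E-t30 gen 2, p439256), every input BY NAME. SOURCE: K. Joshi, *Construction of
Arithmetic Teichmüller Spaces IV*, arXiv:2403.10430v2 (unrefereed; bib `Joshi2024ATS4`), §6.4 p.59 l.25 – p.60 l.28 (Lemmas
6.4.1, 6.4.2), §6.12 p.72 l.2–31 («Proof of Theorem 6.1.1 … Finally one uses ℓ ≥ 7»), §7.1 p.73 l.9–35, §7.2 p.75 l.27–30;
page/line = the cell's render `HOME/lit/renders/Joshi-arxiv-2403.10430/`.

FRAMING (binding): this file COMPOSES implications between statements typed from a third party's unrefereed text. It takes NO side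
on [IUTchIII] Cor 3.12 / [IUTchIV] Thm 1.10, on Joshi's claims, or on Mochizuki's report on them, and makes NO abc claim: every
printed assertion of Joshi's descent that is not a classical number-field fact is a HYPOTHESIS by name (E-t31's `LocusVolumeDatum.*`
inputs of §6.8–§6.11 — among them `LowerBound` = [J-III] Cor 9.11.1.1 at `φ(y₀)`, Joshi's analogue of Cor 3.12 —, the glue
`MainBoundGlue`, T-29's «prime of Lemma 5.8.7» `IsLem587Prime`); the conclusion `Thm721` / `ABC` is reached ONLY under them.
Typed ≠ proved; typed AS A CANDIDATE ≠ endorsed.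

WHAT IS HERE (all PROVED, composition only).
1. `thm611Consumed_of_lem642b` — p437546's per-point junction `thm611Consumed_of_descentInputs` with its §6.4 triple
   `Lem641 ∧ WildBoundLp ∧ DegLpLBound` (Lemma 6.4.1, Joshi's Thm 4.6.1 (5) for `L′/L`, `[L′ : L] ≤ ℓ⁴`) replaced by the single
   statement they serve in §6.12, Lemma 6.4.2 (2) `M.Lem642b` (E-t30's `MainBoundDatum.thm611_left_of_lem642b`, p439256, ∘ the g2
   bridge `thm611Consumed_of_thm611Left`). `WildBoundLp` — T-30's reading of Joshi's Thm 4.6.1 (5) for `L′/L`, which p439256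
   neither uses nor derives (its docstring «What is NOT here») — thereby leaves the antecedent.
2. `thm611OnLambdaLine_of_descentInputs_lem642b`, `thm721_of_descentInputs_lem642b`, `abc_of_descentInputs_lem642b` — the spine END
   TO END with that collapse: same shape as p437546's `abc_of_descentInputs`, one conjunct lighter.
3. GENUINE TOWERS. `thm611Consumed_ofGenuine_of_descent` — per point, for E-t30's genuine datum `MainBoundDatum.ofGenuine` (the
   numbers of Thm 6.1.1 over Mathlib number fields `L_mod`, `L_tpd → L → L′` with T-26's Tate-divisor data, p439256 §2) on a Galois
   tower with `[L : L_tpd] ∣ 2¹⁰·3²·5`, `[L′ : L] ∣ ℓ(ℓ−1)²(ℓ+1)`, supports pulled back, and the unramified/tame conditions of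
   `ofGenuine_lem642b` (the tree's [IUTchIV] Step (ii) engine): the §6.8–§6.11 inputs + glue + `ℓ ≥ 7` + the point identifications
   ⟹ `Thm611Consumed d P ℓ` with NO §6.4 hypothesis (`ofGenuine_thm611_left_of_descent` ∘ `thm611Consumed_of_thm611Left`);
   `thm611_ofGenuine_of_descent` — under the same inputs Theorem 6.1.1 AS PRINTED (both inequalities) holds for the genuine datum.
   `abc_of_genuineDescentInputs` — the spine END TO END when every λ-line point off the exceptional set carries such a genuine tower:
   the per-point binder lists number fields, Tate-divisor data, Galois/degree/ramification CONDITIONS (classical, checkable), E-t31's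
   carrier with its named §6.8–§6.11 inputs, the glue, and the identifications with the point — and nothing of §6.4.
RUNG CURRENCY (A2.E, §M E5 sentence): the kernel sentence «Joshi's descent inputs at every λ-line point ⟹ `ABC` as typed» now
reads, on genuine towers, with antecedent = {[J-III] Cor 9.11.1.1 at `φ(y₀)` (`LowerBound`), (6.11.1), Prop 6.10.9 on `V^dst_ℚ`,
the component sums, (6.8.11), Lemma 6.7.8, the two Frobenius-shift equalities, «(1/2ℓ) log q = |log q_ℓ|», glue, `ℓ ≥ 7`,
classical tower conditions, point identifications}. Nothing is discharged of the §6.8–§6.11 list here. RELATION TO OUR `Statement`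
(recorded, not imported — R14): as in p437546 (X-03 p428664, X-13). Shape (E-PLAN R2/R9): volume-shaped, S-bypassed; no TEST line.
[claim: Joshi2024ATS4, status: disputed]; [claim: Joshi2024ATS3, status: disputed].
-/

noncomputable section

namespace Summit.ABC.IUTFork.Joshi.ATS4

open Literature.NumberTheory.DiophantineGeometry Literature.NumberTheory.DiophantineGeometry.GenEll
open Literature.NumberTheory.EllipticCurves
open Literature.IUT.LogVolume Literature.IUT.LogVolume.Cor22
open NumberField IsDedekindDomain

/-! ## 1. Per point: the §6.4 triple collapsed to Lemma 6.4.2 (2) -/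

section PerPoint

variable {M : MainBoundDatum} {dd : LocusVolumeDatum} (G : MainBoundGlue M dd)
include G

/-- **Per point, E-t31's spine into §7 with the §6.4 inputs collapsed** (§6.12 p.72 l.2–31 then p.73 l.13–35): Lemma 6.4.2 (2)
`M.Lem642b` (p.60 l.6–21) — the only form in which Lemma 6.4.1, Thm 4.6.1 (5) for `L′/L` and `[L′ : L] ≤ ℓ⁴` enter §6.12 —, the
§6.8–§6.11 inputs on E-t31's carrier ((6.11.1), Prop 6.10.9 on `V^dst_ℚ`, the component sums, (6.8.11), Lemma 6.7.8, the LOWER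
BOUND = [J-III] Cor 9.11.1.1 at `φ(y₀)`, the two Frobenius-shift equalities, «(1/2ℓ) log q = |log q_ℓ|»), the glue, `ℓ ≥ 7`, and
the identifications with the point ⟹ `Thm611Consumed d P ℓ`. PROVED (composition: `MainBoundDatum.thm611_left_of_lem642b` ∘
`thm611Consumed_of_thm611Left`). [claim: Joshi2024ATS4, status: disputed] -/
theorem thm611Consumed_of_lem642b (h7 : 7 ≤ M.ell) (h642b : M.Lem642b)
    (h₁ : dd.Eq6111) (h₂ : ∀ p ∈ dd.Vdst, dd.Prop6109 p) (h₃ : dd.ComponentSums) (h₅ : dd.Eq6811) (h₆ : dd.Lem678)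
    (h₇ : dd.LowerBound) (h₈ : dd.FrobShiftQ) (h₉ : dd.FrobShiftVol) (hD : dd.LogqDictionary)
    {d : ℕ} (hdmod : M.dmod ≤ d) (P : NFPoint) (hq : M.logq = logQAvoid P {2, M.ell})
    (hLD : M.logDiffLtpd + M.logCondLtpd = P.logDiff + P.logCond) : Thm611Consumed d P M.ell :=
  thm611Consumed_of_thm611Left M
    (MainBoundDatum.thm611_left_of_lem642b G h7 h642b h₁ h₂ h₃ h₅ h₆ h₇ h₈ h₉ hD) hdmod P hq hLD

variable {lstar : ℕ} {W : Type} [Fintype W] {D : SecondMainBoundDatum lstar W} (G' : DescentGlue D dd)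
include G'

/-- **Per point, collapsed §6.4, with the lower bound supplied by E-t4's typing of [J-III] Cor 9.11.1.1 at `φ(y₀)`**
(`D.shift.Cor91111`, p428048; `DescentGlue.lowerBound_of_cor91111`, p.66 l.41–43 / p.67 l.37–40) ⟹ `Thm611Consumed d P ℓ`.
PROVED (composition). [claim: Joshi2024ATS4, status: disputed] -/
theorem thm611Consumed_of_cor91111_lem642b (hc : D.shift.Cor91111) (h7 : 7 ≤ M.ell) (h642b : M.Lem642b)
    (h₁ : dd.Eq6111) (h₂ : ∀ p ∈ dd.Vdst, dd.Prop6109 p) (h₃ : dd.ComponentSums) (h₅ : dd.Eq6811) (h₆ : dd.Lem678)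
    (h₈ : dd.FrobShiftQ) (h₉ : dd.FrobShiftVol) (hD : dd.LogqDictionary)
    {d : ℕ} (hdmod : M.dmod ≤ d) (P : NFPoint) (hq : M.logq = logQAvoid P {2, M.ell})
    (hLD : M.logDiffLtpd + M.logCondLtpd = P.logDiff + P.logCond) : Thm611Consumed d P M.ell :=
  thm611Consumed_of_lem642b G h7 h642b h₁ h₂ h₃ h₅ h₆ (G'.lowerBound_of_cor91111 hc h₈) h₈ h₉ hD hdmod P hq hLD

end PerPoint

/-! ## 2. The spine END TO END with the collapsed §6.4 conjunct -/

/-- **λ-line, collapsed §6.4** (p.73 l.9–13): off an exceptional set of bounded height, at every point a prime `ℓ` of Lemma 5.8.7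
carrying glued §6 data satisfying Lemma 6.4.2 (2) and the named §6.8–§6.11 inputs ⟹ T-33's residual `Thm611OnLambdaLine Z d`.
PROVED (packaging). [claim: Joshi2024ATS4, status: disputed] -/
theorem thm611OnLambdaLine_of_descentInputs_lem642b {Z : CBData} {d : ℕ} (Exc : Set NFPoint)
    (hExc : ∃ H : ℝ, ∀ P ∈ Exc, P.ht ≤ H)
    (glue : ∀ P ∈ Z.toSet ∩ UPle d, P ∉ Exc → ∃ (M : MainBoundDatum) (dd : LocusVolumeDatum), MainBoundGlue M dd ∧
      7 ≤ M.ell ∧ M.Lem642b ∧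
      (dd.Eq6111 ∧ (∀ p ∈ dd.Vdst, dd.Prop6109 p) ∧ dd.ComponentSums ∧ dd.Eq6811 ∧ dd.Lem678 ∧ dd.LowerBound ∧
        dd.FrobShiftQ ∧ dd.FrobShiftVol ∧ dd.LogqDictionary) ∧
      (IsLem587Prime d P M.ell ∧ M.dmod ≤ d ∧ M.logq = logQAvoid P {2, M.ell} ∧
        M.logDiffLtpd + M.logCondLtpd = P.logDiff + P.logCond)) :
    Thm611OnLambdaLine Z d := by
  refine ⟨Exc, hExc, fun P hP hnot => ?_⟩
  obtain ⟨M, dd, G, h7, h642b, ⟨h₁, h₂, h₃, h₅, h₆, h₇, h₈, h₉, hD⟩, ⟨hℓ, hdmod, hq, hLD⟩⟩ := glue P hP hnot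
  exact ⟨M.ell, hℓ, thm611Consumed_of_lem642b G h7 h642b h₁ h₂ h₃ h₅ h₆ h₇ h₈ h₉ hD hdmod P hq hLD⟩

/-- **THE E5 SPINE END TO END, collapsed §6.4, to Thm 7.2.1 as typed** (`thm721_of_thm611OnLambdaLine` ∘ the λ-line above).
An implication; the binders are the printed places of Joshi's descent from [J-III] Cor 9.11.1.1 to abc, none discharged here;
NO abc claim. [claim: Joshi2024ATS4, status: disputed] -/
theorem thm721_of_descentInputs_lem642b
    (h : ∀ Z : CBData, Hypotheses Z → ∀ d : ℕ, 0 < d → ∃ Exc : Set NFPoint, (∃ H : ℝ, ∀ P ∈ Exc, P.ht ≤ H) ∧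
      ∀ P ∈ Z.toSet ∩ UPle d, P ∉ Exc → ∃ (M : MainBoundDatum) (dd : LocusVolumeDatum), MainBoundGlue M dd ∧
        7 ≤ M.ell ∧ M.Lem642b ∧
        (dd.Eq6111 ∧ (∀ p ∈ dd.Vdst, dd.Prop6109 p) ∧ dd.ComponentSums ∧ dd.Eq6811 ∧ dd.Lem678 ∧ dd.LowerBound ∧
          dd.FrobShiftQ ∧ dd.FrobShiftVol ∧ dd.LogqDictionary) ∧
        (IsLem587Prime d P M.ell ∧ M.dmod ≤ d ∧ M.logq = logQAvoid P {2, M.ell} ∧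
          M.logDiffLtpd + M.logCondLtpd = P.logDiff + P.logCond)) : Thm721 :=
  thm721_of_thm611OnLambdaLine fun Z hZ d hd => by
    obtain ⟨Exc, hExc, glue⟩ := h Z hZ d hd
    exact thm611OnLambdaLine_of_descentInputs_lem642b Exc hExc glue

/-- **… and to the summit statement `ABC`** (through `abc_of_thm721` = T-24's `abcConjecture_iff_ABC`). An implication whose
antecedent carries [J-III] Cor 9.11.1.1 at `φ(y₀)` among its named hypotheses; NO abc claim. [claim: Joshi2024ATS4, status: disputed] -/
theorem abc_of_descentInputs_lem642b
    (h : ∀ Z : CBData, Hypotheses Z → ∀ d : ℕ, 0 < d → ∃ Exc : Set NFPoint, (∃ H : ℝ, ∀ P ∈ Exc, P.ht ≤ H) ∧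
      ∀ P ∈ Z.toSet ∩ UPle d, P ∉ Exc → ∃ (M : MainBoundDatum) (dd : LocusVolumeDatum), MainBoundGlue M dd ∧
        7 ≤ M.ell ∧ M.Lem642b ∧
        (dd.Eq6111 ∧ (∀ p ∈ dd.Vdst, dd.Prop6109 p) ∧ dd.ComponentSums ∧ dd.Eq6811 ∧ dd.Lem678 ∧ dd.LowerBound ∧
          dd.FrobShiftQ ∧ dd.FrobShiftVol ∧ dd.LogqDictionary) ∧
        (IsLem587Prime d P M.ell ∧ M.dmod ≤ d ∧ M.logq = logQAvoid P {2, M.ell} ∧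
          M.logDiffLtpd + M.logCondLtpd = P.logDiff + P.logCond)) : ABC :=
  abc_of_thm721 (thm721_of_descentInputs_lem642b h)

/-! ## 3. GENUINE Galois number-field towers: no §6.4 hypothesis at all -/

section Genuine

variable {Lmod : Type*} [Field Lmod] [NumberField Lmod]
variable {Ltpd L L' : Type*} [Field Ltpd] [NumberField Ltpd] [Field L] [NumberField L] [Field L'] [NumberField L']
  [Algebra Ltpd L] [Algebra L L']
variable {ℓ : ℕ} {hℓ : ℓ.Prime} {h5 : 5 ≤ ℓ}
variable {𝔮tpd : TateDivisorDatum Ltpd} {𝔮L : TateDivisorDatum L} {𝔮L' : TateDivisorDatum L'} {hq : 0 < 𝔮L.logq}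
variable {dd : LocusVolumeDatum} (G : MainBoundGlue (MainBoundDatum.ofGenuine Lmod hℓ h5 𝔮tpd 𝔮L 𝔮L' hq) dd)
include G

/-- **Per point on a GENUINE Galois tower: §6.8–§6.11 inputs + glue + `ℓ ≥ 7` ⟹ `Thm611Consumed d P ℓ`, NO §6.4 input**
(§6.12 p.72 l.2–31 then p.73 l.13–35). The datum is E-t30's `MainBoundDatum.ofGenuine` (p.58 l.1–23 over Mathlib number fields
`L_mod`, `L_tpd → L → L′` with T-26's Tate-divisor data); the tower conditions are those of `ofGenuine_lem642b` — `L/L_tpd` and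
`L′/L` Galois, `[L : L_tpd] ∣ 2¹⁰·3²·5` (p.59 l.31), `[L′ : L] ∣ ℓ(ℓ−1)²(ℓ+1)` (Lem 6.3.2, p.60 l.26–27), supports pulled back
(§4.4 p.40 l.35–40), unramified resp. tame outside resp. on `Supp(𝔮)` away from the wild characteristics `{2,3,5}` resp. `{ℓ}`
(the tree's [IUTchIV] Step (ii) reading of Lem 4.1.4; p439256 docstring) —, under which Lemma 6.4.2 (2) is a THEOREM
(`ofGenuine_lem642b`). Point identifications: `d_mod ≤ d`, `log(𝔮_L) = log Q` off `{2, ℓ}`, `log(𝔡^{L_tpd}) + log(𝔣_{L_tpd}) =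
log-diff + log-cond` (p.73 l.13–35, p.75 l.18–20). PROVED (composition: `ofGenuine_thm611_left_of_descent` ∘
`thm611Consumed_of_thm611Left`). [claim: Joshi2024ATS4, status: disputed] -/
theorem thm611Consumed_ofGenuine_of_descent [IsGalois Ltpd L] [IsGalois L L'] (h7 : 7 ≤ ℓ)
    (hV : ∀ w : HeightOneSpectrum (𝓞 L), w ∈ 𝔮L.V ↔ finBelow Ltpd L w ∈ 𝔮tpd.V)
    (hdvd : Module.finrank Ltpd L ∣ 2 ^ 10 * 3 ^ 2 * 5)
    (hunr : ∀ w : HeightOneSpectrum (𝓞 L), residueChar L w ∉ ({2, 3, 5} : Finset ℕ) → finBelow Ltpd L w ∉ 𝔮tpd.V →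
      w.asIdeal.ramificationIdx (𝓞 Ltpd) = 1)
    (htame : ∀ w : HeightOneSpectrum (𝓞 L), residueChar L w ∉ ({2, 3, 5} : Finset ℕ) → finBelow Ltpd L w ∈ 𝔮tpd.V →
      ¬ residueChar L w ∣ w.asIdeal.ramificationIdx (𝓞 Ltpd))
    (hV' : ∀ u : HeightOneSpectrum (𝓞 L'), u ∈ 𝔮L'.V ↔ finBelow L L' u ∈ 𝔮L.V)
    (hdvd' : Module.finrank L L' ∣ ℓ * (ℓ - 1) ^ 2 * (ℓ + 1))
    (hunr' : ∀ u : HeightOneSpectrum (𝓞 L'), residueChar L' u ≠ ℓ → finBelow L L' u ∉ 𝔮L.V →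
      u.asIdeal.ramificationIdx (𝓞 L) = 1)
    (htame' : ∀ u : HeightOneSpectrum (𝓞 L'), residueChar L' u ≠ ℓ → finBelow L L' u ∈ 𝔮L.V →
      ¬ residueChar L' u ∣ u.asIdeal.ramificationIdx (𝓞 L))
    (h₁ : dd.Eq6111) (h₂ : ∀ p ∈ dd.Vdst, dd.Prop6109 p) (h₃ : dd.ComponentSums) (h₅ : dd.Eq6811) (h₆ : dd.Lem678)
    (h₇ : dd.LowerBound) (h₈ : dd.FrobShiftQ) (h₉ : dd.FrobShiftVol) (hD : dd.LogqDictionary)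
    {d : ℕ} (hdmod : dMod Lmod ≤ d) (P : NFPoint) (hqP : 𝔮L.logq = logQAvoid P {2, ℓ})
    (hLD : logDifferent Ltpd + 𝔮tpd.logf = P.logDiff + P.logCond) : Thm611Consumed d P ℓ :=
  thm611Consumed_of_thm611Left (MainBoundDatum.ofGenuine Lmod hℓ h5 𝔮tpd 𝔮L 𝔮L' hq)
    (MainBoundDatum.ofGenuine_thm611_left_of_descent G h7 hV hdvd hunr htame hV' hdvd' hunr' htame' h₁ h₂ h₃ h₅ h₆ h₇
      h₈ h₉ hD) hdmod P hqP hLD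

/-- **Theorem 6.1.1 AS PRINTED — both inequalities (p.58 l.1–23) — on a GENUINE Galois tower from the §6.8–§6.11 inputs +
glue + `ℓ ≥ 7`, NO §6.4 input**: the first inequality by `ofGenuine_thm611_left_of_descent`, the second (`L_tpd` vs `L`,
p.58 l.17–23 = Thm 4.6.1 (2)) by `ofGenuine_thm611_iff` from support compatibility (both E-t30 gen 2, p439256). With T-33's
`thm611Consumed_of_mainBoundDatum` (p433630) this is the printed §6.1 ⟶ §7.1 junction on genuine data. PROVED (composition);
the [J-III] lower bound and the §6.8–§6.11 identities stay HYPOTHESES BY NAME. [claim: Joshi2024ATS4, status: disputed] -/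
theorem thm611_ofGenuine_of_descent [IsGalois Ltpd L] [IsGalois L L'] (h7 : 7 ≤ ℓ)
    (hV : ∀ w : HeightOneSpectrum (𝓞 L), w ∈ 𝔮L.V ↔ finBelow Ltpd L w ∈ 𝔮tpd.V)
    (hdvd : Module.finrank Ltpd L ∣ 2 ^ 10 * 3 ^ 2 * 5)
    (hunr : ∀ w : HeightOneSpectrum (𝓞 L), residueChar L w ∉ ({2, 3, 5} : Finset ℕ) → finBelow Ltpd L w ∉ 𝔮tpd.V →
      w.asIdeal.ramificationIdx (𝓞 Ltpd) = 1)
    (htame : ∀ w : HeightOneSpectrum (𝓞 L), residueChar L w ∉ ({2, 3, 5} : Finset ℕ) → finBelow Ltpd L w ∈ 𝔮tpd.V →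
      ¬ residueChar L w ∣ w.asIdeal.ramificationIdx (𝓞 Ltpd))
    (hV' : ∀ u : HeightOneSpectrum (𝓞 L'), u ∈ 𝔮L'.V ↔ finBelow L L' u ∈ 𝔮L.V)
    (hdvd' : Module.finrank L L' ∣ ℓ * (ℓ - 1) ^ 2 * (ℓ + 1))
    (hunr' : ∀ u : HeightOneSpectrum (𝓞 L'), residueChar L' u ≠ ℓ → finBelow L L' u ∉ 𝔮L.V →
      u.asIdeal.ramificationIdx (𝓞 L) = 1)
    (htame' : ∀ u : HeightOneSpectrum (𝓞 L'), residueChar L' u ≠ ℓ → finBelow L L' u ∈ 𝔮L.V →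
      ¬ residueChar L' u ∣ u.asIdeal.ramificationIdx (𝓞 L))
    (h₁ : dd.Eq6111) (h₂ : ∀ p ∈ dd.Vdst, dd.Prop6109 p) (h₃ : dd.ComponentSums) (h₅ : dd.Eq6811) (h₆ : dd.Lem678)
    (h₇ : dd.LowerBound) (h₈ : dd.FrobShiftQ) (h₉ : dd.FrobShiftVol) (hD : dd.LogqDictionary) :
    (MainBoundDatum.ofGenuine Lmod hℓ h5 𝔮tpd 𝔮L 𝔮L' hq).Thm611 :=
  (MainBoundDatum.ofGenuine_thm611_iff Lmod hℓ h5 𝔮tpd 𝔮L 𝔮L' hq hV).2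
    (MainBoundDatum.ofGenuine_thm611_left_of_descent G h7 hV hdvd hunr htame hV' hdvd' hunr' htame' h₁ h₂ h₃ h₅ h₆ h₇
      h₈ h₉ hD)

end Genuine

/-- **THE E5 SPINE END TO END ON GENUINE TOWERS, to `ABC` as typed — no §6.4 conjunct.** If at every compactly bounded `Z` with
(5.6.2) (`Cor22.Hypotheses`) and every `d ≥ 1`, off an exceptional set of bounded height (Thm 5.7.1, p.73 l.9–13), every point
carries a prime `ℓ ≥ 7` of Lemma 5.8.7 and a GENUINE Galois tower of number fields `L_mod`, `L_tpd → L → L′` with Tate-divisor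
data satisfying the classical conditions of `thm611Consumed_ofGenuine_of_descent`, glued (E-t31's `MainBoundGlue`) to a §6.8–§6.11
carrier `dd` satisfying its NAMED inputs — (6.11.1), Prop 6.10.9 on `V^dst_ℚ`, the component sums, (6.8.11), Lemma 6.7.8, the
LOWER BOUND = [J-III] Cor 9.11.1.1 at `φ(y₀)`, the two Frobenius-shift equalities, «(1/2ℓ) log q = |log q_ℓ|» — and identified
with the point, then `ABC` (`abc_of_thm721` ∘ `thm721_of_thm611OnLambdaLine`). PROVED AS AN IMPLICATION: the antecedent is the
list of printed places of Joshi's descent MINUS §6.4 (a theorem there, p439256); nothing of §6.8–§6.11 or of [J-III] is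
discharged; NO abc claim. [claim: Joshi2024ATS4, status: disputed] -/
theorem abc_of_genuineDescentInputs
    (h : ∀ Z : CBData, Hypotheses Z → ∀ d : ℕ, 0 < d → ∃ Exc : Set NFPoint, (∃ H : ℝ, ∀ P ∈ Exc, P.ht ≤ H) ∧
      ∀ P ∈ Z.toSet ∩ UPle d, P ∉ Exc →
        ∃ (Lmod Ltpd L L' : Type) (_ : Field Lmod) (_ : NumberField Lmod) (_ : Field Ltpd) (_ : NumberField Ltpd)
          (_ : Field L) (_ : NumberField L) (_ : Field L') (_ : NumberField L') (_ : Algebra Ltpd L) (_ : Algebra L L')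
          (_ : IsGalois Ltpd L) (_ : IsGalois L L') (ℓ : ℕ) (hℓ : ℓ.Prime) (h5 : 5 ≤ ℓ)
          (𝔮tpd : TateDivisorDatum Ltpd) (𝔮L : TateDivisorDatum L) (𝔮L' : TateDivisorDatum L') (hq : 0 < 𝔮L.logq)
          (dd : LocusVolumeDatum), MainBoundGlue (MainBoundDatum.ofGenuine Lmod hℓ h5 𝔮tpd 𝔮L 𝔮L' hq) dd ∧ 7 ≤ ℓ ∧
          ((∀ w : HeightOneSpectrum (𝓞 L), w ∈ 𝔮L.V ↔ finBelow Ltpd L w ∈ 𝔮tpd.V) ∧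
            Module.finrank Ltpd L ∣ 2 ^ 10 * 3 ^ 2 * 5 ∧
            (∀ w : HeightOneSpectrum (𝓞 L), residueChar L w ∉ ({2, 3, 5} : Finset ℕ) → finBelow Ltpd L w ∉ 𝔮tpd.V →
              w.asIdeal.ramificationIdx (𝓞 Ltpd) = 1) ∧
            (∀ w : HeightOneSpectrum (𝓞 L), residueChar L w ∉ ({2, 3, 5} : Finset ℕ) → finBelow Ltpd L w ∈ 𝔮tpd.V →
              ¬ residueChar L w ∣ w.asIdeal.ramificationIdx (𝓞 Ltpd)) ∧
            (∀ u : HeightOneSpectrum (𝓞 L'), u ∈ 𝔮L'.V ↔ finBelow L L' u ∈ 𝔮L.V) ∧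
            Module.finrank L L' ∣ ℓ * (ℓ - 1) ^ 2 * (ℓ + 1) ∧
            (∀ u : HeightOneSpectrum (𝓞 L'), residueChar L' u ≠ ℓ → finBelow L L' u ∉ 𝔮L.V →
              u.asIdeal.ramificationIdx (𝓞 L) = 1) ∧
            (∀ u : HeightOneSpectrum (𝓞 L'), residueChar L' u ≠ ℓ → finBelow L L' u ∈ 𝔮L.V →
              ¬ residueChar L' u ∣ u.asIdeal.ramificationIdx (𝓞 L))) ∧
          (dd.Eq6111 ∧ (∀ p ∈ dd.Vdst, dd.Prop6109 p) ∧ dd.ComponentSums ∧ dd.Eq6811 ∧ dd.Lem678 ∧ dd.LowerBound ∧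
            dd.FrobShiftQ ∧ dd.FrobShiftVol ∧ dd.LogqDictionary) ∧
          (IsLem587Prime d P ℓ ∧ dMod Lmod ≤ d ∧ 𝔮L.logq = logQAvoid P {2, ℓ} ∧
            logDifferent Ltpd + 𝔮tpd.logf = P.logDiff + P.logCond)) : ABC :=
  abc_of_thm721 <| thm721_of_thm611OnLambdaLine fun Z hZ d hd => by
    obtain ⟨Exc, hExc, glue⟩ := h Z hZ d hd
    refine ⟨Exc, hExc, fun P hP hnot => ?_⟩
    obtain ⟨Lmod, Ltpd, L, L', _, _, _, _, _, _, _, _, _, _, _, _, ℓ, hℓ, h5, 𝔮tpd, 𝔮L, 𝔮L', hq, dd, G, h7,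
      ⟨hV, hdvd, hunr, htame, hV', hdvd', hunr', htame'⟩, ⟨h₁, h₂, h₃, h₅, h₆, h₇, h₈, h₉, hD⟩, ⟨hℓP, hdmod, hqP, hLD⟩⟩ :=
      glue P hP hnot
    exact ⟨ℓ, hℓP, thm611Consumed_ofGenuine_of_descent G h7 hV hdvd hunr htame hV' hdvd' hunr' htame' h₁ h₂ h₃ h₅ h₆ h₇
      h₈ h₉ hD hdmod P hqP hLD⟩

end Summit.ABC.IUTFork.Joshi.ATS4

end
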